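import Literature.Analysis.FluidPDE.HardSphereCollisionEnumeration
import HarnessLib

/-!
# The coarse pre-collision history of a collision and its σ-algebra

Companion to `Literature.Analysis.FluidPDE.HardSphereCollisionRecord` (collision records, the
collision DAG, the `n`-th collision `HardSphereFlow.nthCollisionTimeOf Φ i n z` of a particle along
the hard-sphere flow, and the two-snapshot, exact-velocity COARSE PAST `HardSphereFlow.coarsePastOf`
with its σ-algebra `coarsePastSigma`) and to `HardSphereCollisionEnumeration` (the enumerators
`nthCollisionTime` / `nthCollisionTimeOf` list the collision times increasingly). For conditional
statements "given the coarse history of the dynamics strictly before a collision" — conditional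
kick isotropy layer by layer, decaying-memory clauses along the collision DAG, martingale
differences of kick functionals — one needs, for each collision `c` = the `n`-th collision of
particle `i` after time `0`, a σ-algebra on initial data that (i) sees a COARSE-GRAINED history only
(position cells AND velocity-direction cells: cumulative exact velocities together with the
collision graph pin the microstate after a few collisions per sphere), (ii) sees everything strictly
before `c` and nothing at or after `c`, and (iii) is monotone along the DAG (an earlier collision's
σ-algebra is contained in a later one's, in the stopping-time sense), so that conditional
expectations given these σ-algebras compose. This file provides that vocabulary, pure
bookkeeping with no statement about laws (Gallagher–Saint-Raymond–Texier 2013 §4.1 for the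
collisions of the flow; Aoki–Pulvirenti–Simonella–Tsuji 2015 §5 for the time-ordered collision
sequence `{t_m}, {(p_m, q_m)}` of a trajectory; the σ-algebras are the internal-history /
stopping-time σ-fields of this marked collision sequence, Brémaud 2020 Thm. 13.2.4 and (15.5)):

* `coarseConfigWith q qv z : Fin N → C × C'` — positions through `q : X → C`, velocities through
  `qv : ℝ^d → C'` (`coarseConfig q` is `qv = id`, `coarseConfigWith_id`); measurable when `q`,
  `qv` are (`measurable_coarseConfigWith`).
* `directionSpeedCell η v = (⌊v̂_i / η⌋)_i, ‖v‖)` — direction cells of size `η` on the unit sphere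
  through the ambient coordinates of `v̂ = v/‖v‖`, EXACT speed; measurable
  (`measurable_directionSpeedCell`).
* `collidingSet G ε z` — the particles in contact (`= {p, q}` at a collision of a trajectory,
  `IsHardSphereTrajectory.collidingSet_eq_pair`); `kickEntry G ε q qv z : KickEntry N C C' ⊕ Unit`
  — the COARSE ENTRY of the collision happening in `z`: the colliding pair `(k₁, k₂)`, `k₁ < k₂`,
  and the cells `(q x_k, qv v_k⁺)` of its two members read off the (post-collisional) configuration,
  i.e. the data of the two free flights STARTING at this collision; blank (`Sum.inr ()`) if nobody
  is in contact.
* `KickLog N C C' = (Fin N → C × C') × (ℕ → KickEntry N C C' ⊕ Unit)` — initial coarse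
  configuration + a sequence of slots; `kickLog G ε γ q qv a` — the log of the curve `γ` after
  time `a` (slot `m` = entry at the `m`-th collision time after `a`); the combinatorics of slot
  sequences: `KickLog.Involves`, the occurrence count `KickLog.occBefore i e m` (slots `< m`
  involving `i`), the TRUNCATION `KickLog.truncSeq i n` / `KickLog.truncBefore i n` (blank every
  slot from the `(n+1)`-st slot involving `i` on), `KickLog.Records i n L` (`L` has more than `n`
  slots involving `i`), with `truncSeq_truncSeq` (nested truncations), `truncSeq_truncSeq_of_le`
  (one particle), and the measurability of all of these for the product σ-algebra.
* `preCollisionLog G ε γ q qv a i n = truncBefore i n (kickLog …)` and, along a flow,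
  `HardSphereFlow.preCollisionHistory Φ q qv i n z` — the **coarse pre-collision history of the
  `n`-th collision of `i`**: the coarse initial datum and the time-ordered coarse entries of the
  collisions at times `0 < s < t_c` (`HardSphereFlow.preCollisionHistory_spec`: on the good set,
  when `i` does collide more than `n` times, the kept slots are exactly the collisions strictly
  before `t_c = Φ.nthCollisionTimeOf i n z`, increasingly, and everything else is blank).
* `HardSphereFlow.preCollisionSigma Φ q qv i n = MeasurableSpace.comap (preCollisionHistory …)` —
  the **pre-collision σ-algebra**; `preCollisionSigma_le` (a sub-σ-algebra of the ambient one when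
  the history map is measurable), `preCollisionSigma_mono` (a FILTRATION in `n` along each
  particle, exactly), `HardSphereFlow.precedes Φ q qv i' n' i n` (the event that the `n'`-th
  collision of `i'` is logged strictly before the `n`-th of `i`; `measurableSet_precedes`: it is
  `preCollisionSigma i n`-measurable; `mem_precedes_iff_lt`: on the good set it IS time
  precedence of genuine collisions), and the DAG MONOTONICITY in strict-past form
  `MeasurableSet.inter_precedes`: `E ∈ 𝓕(i', n') ⇒ E ∩ precedes ∈ 𝓕(i, n)`
  (`𝓕_{c'} ∩ {c' ≺ c} ⊆ 𝓕_c`), with the factorisation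
  `preCollisionHistory_eq_of_mem_precedes` of the earlier history through the later one.
* enumeration with enough elements: `nthTimeAfter_chain_of_encard`, `nthTimeAfter_enum_of_encard`
  (if `S` has more than `n` elements after `a` — `(n + 1 : ℕ∞) ≤ (S ∩ Ioi a).encard`, implied by
  the window counts `n + 1 ≤ ncard (S ∩ Ioc a w)` of the routes, `le_encard_inter_Ioi_of_le_ncard`
  — then `j ↦ nthTimeAfter S a j`, `j ≤ n`, is the increasing bijection onto `S ∩ (a, t_n]`, no
  junk), specialised in `IsHardSphereTrajectory.nthCollisionTimeOf_enum_of_encard`,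
  `ncard_collisionTimesOf_inter_Ioo`.

## Mathlib / Literature reuse

`MeasurableSpace.comap`/`comap_comp`/`comap_mono`, `Measurable.comap_le`, `comap_measurable`, the
product/`Pi`/`Sum` measurable structures, `Measurable.ite`, `Measurable.of_discrete`,
`Set.encard`/`Set.ncard` (`encard_sdiff_singleton_of_mem`, `InjOn.ncard_image`),
`strictMonoOn_Iic_of_lt_succ`, `Finset.min'`/`max'`, `Int.measurable_floor` are Mathlib's; the
kinetic kit (`contactPairs`, `Participates`, `collisionTimes(Of)`, `nextTimeAfter`, `nthTimeAfter`,
`nthCollisionTime(Of)`, `IsHardSphereTrajectory.participates_iff`, `nthTimeAfter_enum`,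
`nthCollisionTime_enum`, `HardSphereFlow.nthCollisionTimeOf`, `coarseConfig`, `Torus.coarseCell`) is
the record / enumeration files'. Mathlib has no `MeasurableSpace` structure on `List` or `Option`,
whence the carrier `ℕ → KickEntry ⊕ Unit` (blank slots) instead of a list of entries; Mathlib's
filtrations (`MeasureTheory.Filtration`) are indexed by a fixed preorder, whereas the collisions of
an orbit are partially ordered in a datum-dependent way, whence the strict-past formulation of
monotonicity through the event `precedes`.

## Design choices

* WHAT IS RECORDED. Per collision strictly before `t_c`: the colliding pair and, for each of its two
  members, the `q`-cell of its position and the `qv`-cell of its OUTGOING velocity — exactly the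
  data (particle, DAG edge, start cell, velocity cell) of every free flight that starts strictly
  before `t_c` — plus the coarse initial datum (the flights starting at time `0`). NOT recorded:
  collision times, anything at or after `t_c` (neither the pair nor the incoming data of the
  collision `c` itself: enlarge by `⊔ MeasurableSpace.comap (Φ.nthPartnerOf i n) ⊤` if the
  partner's identity is wanted), and no cell of a particle in free flight at somebody else's
  collision (recording all particles' cells at every collision time would observe each free
  flight on a dense set of times and defeat the coarse-graining of directions).
* TRUNCATION IS COMBINATORIAL. The history is the FULL kick log of the orbit (slot `m` = entry at
  the `m`-th collision time after `0`, for every `m`) truncated before the `(n+1)`-st slot involving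
  `i`, rather than "the entries at the collision times `< Φ.nthCollisionTimeOf i n z`". The two
  agree on the good set whenever `i` collides more than `n` times (`preCollisionHistory_spec`),
  and the combinatorial form makes the σ-algebra statements EXACT (no null sets, no good set):
  nested truncations commute (`KickLog.truncBefore_truncBefore`), so `n ↦ preCollisionSigma i n` is
  monotone and `𝓕_{c'} ∩ {c' ≺ c} ⊆ 𝓕_c` holds on the nose, the dynamics entering only the
  INTERPRETATION of the kept slots and of the event `precedes` (`mem_precedes_iff`,
  `mem_precedes_iff_lt`, stated on `Φ.good` under the genuineness hypothesis
  `(n + 1 : ℕ∞) ≤ encard (collisionTimesOf i ∩ Ioi 0)`).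
* The colliding pair of an entry is `(min, max)` of the colliding set (a canonical order; records
  attached to a particle use `(i, partner)` instead); at a binary collision `Involves i entry ↔
  Participates i` (`IsHardSphereTrajectory.involves_kickEntry_iff`).
* Junk values (documented at each definition): blank entry off the collision times; past the last
  collision the enumerators cycle through junk and so does the log — invisible after truncation at
  a genuine collision; off `Φ.good` everything is junk; `directionSpeedCell η 0 = (0, 0)`.
* Deliberately NOT here: measurability of `z ↦ Φ.preCollisionHistory q qv i n z` (it needs joint
  measurability of the flow and of the collision times in the datum, cf.
  `HardSphereFlowJointMeasurable`; `preCollisionSigma_le` takes it as a hypothesis, as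
  `coarsePastSigma_le` does), the layer σ-algebras generated by all collisions of DAG depth `≤ k`
  (the depth of a collision is a function of its pre-collision log; not developed), and any
  statement about laws.

## References

* I. Gallagher, L. Saint-Raymond, B. Texier, *From Newton to Boltzmann: hard spheres and
  short-range potentials*, EMS (2013), §4.1 (collisions of the hard-sphere flow).
* K. Aoki, M. Pulvirenti, S. Simonella, T. Tsuji, *Backward clusters, hierarchy and wild sums for a
  hard sphere system in a low-density regime*, M3AS 25 (2015), §5 (the time-ordered collision
  sequence `{t_m}, {(p_m, q_m)}` of a trajectory).
* P. Brémaud, *Probability Theory and Stochastic Processes*, Universitext, Springer (2020),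
  Thm. 13.2.4 (the σ-field `𝓕_τ` of a stopping time of a discrete history and its monotonicity),
  Eq. (15.5) (the internal history of a marked point process). [cite key `Bremaud2020`]
-/

open Set Function MeasureTheory
open scoped ENNReal

namespace Literature.Analysis.FluidPDE

noncomputable section

/-! ## Coarse-graining of configurations with velocity cells -/

section CoarseWith

variable {d : Type*} {X : Type*} {N : ℕ}

/-- The **coarse-grained configuration with velocity cells**: positions seen through a
coarse-graining map `q : X → C`, velocities through `qv : ℝ^d → C'` (`coarseConfig q` is the case
`qv = id` of exact velocities, `coarseConfigWith_id`). [folklore] -/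
def coarseConfigWith {C C' : Type*} (q : X → C) (qv : EuclideanSpace ℝ d → C') (z : Config N d X) :
    Fin N → C × C' :=
  fun k => (q (z k).1, qv (z k).2)

/-- Unfolding lemma for the coarse-grained configuration with velocity cells. [folklore] -/
@[simp]
theorem coarseConfigWith_apply {C C' : Type*} (q : X → C) (qv : EuclideanSpace ℝ d → C')
    (z : Config N d X) (k : Fin N) : coarseConfigWith q qv z k = (q (z k).1, qv (z k).2) := rfl

/-- With exact velocities (`qv = id`) the coarse-grained configuration with velocity cells is
`coarseConfig`. [folklore] -/
theorem coarseConfigWith_id {C : Type*} (q : X → C) (z : Config N d X) :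
    coarseConfigWith q id z = coarseConfig q z := rfl

/-- The coarse-grained configuration with velocity cells is measurable in the configuration when
both cell maps are. [folklore] -/
theorem measurable_coarseConfigWith [MeasurableSpace X] {C C' : Type*} [MeasurableSpace C]
    [MeasurableSpace C'] {q : X → C} {qv : EuclideanSpace ℝ d → C'} (hq : Measurable q)
    (hqv : Measurable qv) : Measurable (coarseConfigWith (N := N) q qv) := by
  refine measurable_pi_lambda _ fun k => ?_
  exact (hq.comp (measurable_pi_apply k).fst).prodMk (hqv.comp (measurable_pi_apply k).snd)

end CoarseWith

/-! ## Direction cells: coarse-grained velocity directions, exact speeds -/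

section Direction

variable {d : Type*} [Fintype d]

/-- The **direction–speed cell** of a velocity `v ∈ ℝ^d` at angular resolution `η`: the integer
vector `⌊v̂_i / η⌋` of the ambient coordinates of the unit vector `v̂ = ‖v‖⁻¹ v` (cells of size `η`
on the unit sphere, through the coordinates of `ℝ^d`; `v̂ = 0` for `v = 0`) together with the
EXACT speed `‖v‖`. [folklore] -/
def directionSpeedCell (η : ℝ) (v : EuclideanSpace ℝ d) : (d → ℤ) × ℝ :=
  (fun i => ⌊(‖v‖⁻¹ • v) i / η⌋, ‖v‖)

/-- Unfolding lemma for the direction–speed cell. [folklore] -/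
@[simp]
theorem directionSpeedCell_apply (η : ℝ) (v : EuclideanSpace ℝ d) :
    directionSpeedCell η v = (fun i => ⌊(‖v‖⁻¹ • v) i / η⌋, ‖v‖) := rfl

/-- The speed component of the direction–speed cell is the exact speed. [folklore] -/
theorem directionSpeedCell_snd (η : ℝ) (v : EuclideanSpace ℝ d) : (directionSpeedCell η v).2 = ‖v‖ :=
  rfl

/-- The direction–speed cell map is measurable. [folklore] -/
theorem measurable_directionSpeedCell (η : ℝ) : Measurable (directionSpeedCell (d := d) η) := by
  have hunit : Measurable fun v : EuclideanSpace ℝ d => ‖v‖⁻¹ • v :=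
    measurable_norm.inv.smul measurable_id
  refine (measurable_pi_lambda _ fun i => ?_).prodMk measurable_norm
  have hi : Measurable fun v : EuclideanSpace ℝ d => (‖v‖⁻¹ • v) i :=
    (measurable_pi_apply (X := fun _ : d => ℝ) i).comp
      ((WithLp.measurable_ofLp 2 (d → ℝ)).comp hunit)
  exact Int.measurable_floor.comp (hi.div_const η)

end Direction

/-! ## Coarse kick entries and kick logs: the combinatorial carrier of histories -/

/-- The **coarse entry of one collision** ("kick") of `N` particles with position cells in `C`
and velocity cells in `C'`: the colliding pair `(k₁, k₂)` in increasing label order and the coarse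
post-collisional states `((q x_{k₁}, qv v_{k₁}⁺), (q x_{k₂}, qv v_{k₂}⁺))` of its two members — the
data of the two free flights that START at this collision (particle, start cell, velocity cell).
[folklore] -/
abbrev KickEntry (N : ℕ) (C C' : Type*) : Type _ := (Fin N × Fin N) × ((C × C') × (C × C'))

/-- A **coarse kick log**: an initial coarse configuration together with a sequence of slots, the
`m`-th slot holding the coarse entry of the `m`-th collision (`Sum.inl`) or nothing (`Sum.inr ()`,
a blank slot). Carries the product σ-algebra (Mathlib's instances for products, countable
products and sums). [folklore] -/
abbrev KickLog (N : ℕ) (C C' : Type*) : Type _ := (Fin N → C × C') × (ℕ → KickEntry N C C' ⊕ Unit)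

namespace KickLog

variable {N : ℕ} {C C' : Type*}

/-- The slot `x` is a (non-blank) entry whose colliding pair contains particle `i`. [folklore] -/
def Involves (i : Fin N) : KickEntry N C C' ⊕ Unit → Prop
  | Sum.inl e => e.1.1 = i ∨ e.1.2 = i
  | Sum.inr _ => False

/-- `Involves` is decidable. [folklore] -/
instance decidableInvolves (i : Fin N) (x : KickEntry N C C' ⊕ Unit) : Decidable (Involves i x) :=
  match x with
  | Sum.inl e => inferInstanceAs (Decidable (e.1.1 = i ∨ e.1.2 = i))
  | Sum.inr _ => inferInstanceAs (Decidable False)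

/-- Unfolding lemma: an entry involves `i` iff `i` is one of its two colliding particles.
[folklore] -/
@[simp]
theorem involves_inl {i : Fin N} {e : KickEntry N C C'} : Involves i (Sum.inl e) ↔ e.1.1 = i ∨ e.1.2 = i :=
  Iff.rfl

/-- A blank slot involves nobody. [folklore] -/
@[simp]
theorem not_involves_inr {i : Fin N} {u : Unit} : ¬ Involves i (Sum.inr u : KickEntry N C C' ⊕ Unit) :=
  fun h => h

/-- The **occurrence count**: the number of slots of index `< m` of the sequence `e` involving
particle `i` (the number of collisions of `i` among the first `m` logged collisions). [folklore] -/
def occBefore (i : Fin N) (e : ℕ → KickEntry N C C' ⊕ Unit) : ℕ → ℕ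
  | 0 => 0
  | m + 1 => if Involves i (e m) then occBefore i e m + 1 else occBefore i e m

/-- No slot, no occurrence. [folklore] -/
@[simp]
theorem occBefore_zero (i : Fin N) (e : ℕ → KickEntry N C C' ⊕ Unit) : occBefore i e 0 = 0 := rfl

/-- The recursion of the occurrence count. [folklore] -/
theorem occBefore_succ (i : Fin N) (e : ℕ → KickEntry N C C' ⊕ Unit) (m : ℕ) :
    occBefore i e (m + 1) = occBefore i e m + if Involves i (e m) then 1 else 0 := by
  by_cases h : Involves i (e m)
  · simp [occBefore, h]
  · simp [occBefore, h]

/-- The occurrence count is the cardinality of the set of involved indices below `m`. [folklore] -/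
theorem occBefore_eq_card (i : Fin N) (e : ℕ → KickEntry N C C' ⊕ Unit) (m : ℕ) :
    occBefore i e m = ((Finset.range m).filter fun k => Involves i (e k)).card := by
  induction m with
  | zero => simp
  | succ m ih =>
    rw [occBefore_succ, ih, Finset.range_add_one, Finset.filter_insert]
    by_cases h : Involves i (e m)
    · rw [if_pos h, if_pos h, Finset.card_insert_of_notMem]
      simp
    · rw [if_neg h, if_neg h, add_zero]

/-- The occurrence count is monotone in the number of slots. [folklore] -/
theorem occBefore_mono (i : Fin N) (e : ℕ → KickEntry N C C' ⊕ Unit) : Monotone (occBefore i e) := by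
  refine monotone_nat_of_le_succ fun m => ?_
  rw [occBefore_succ]
  exact Nat.le_add_right _ _

/-- One more slot adds at most one occurrence. [folklore] -/
theorem occBefore_succ_le (i : Fin N) (e : ℕ → KickEntry N C C' ⊕ Unit) (m : ℕ) :
    occBefore i e (m + 1) ≤ occBefore i e m + 1 := by
  rw [occBefore_succ]
  split_ifs <;> omega

/-- Two sequences with the same involvement pattern below `m` have the same occurrence count at
`m`. [folklore] -/
theorem occBefore_congr {i : Fin N} {e e' : ℕ → KickEntry N C C' ⊕ Unit} {m : ℕ}
    (h : ∀ k < m, (Involves i (e k) ↔ Involves i (e' k))) : occBefore i e m = occBefore i e' m := by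
  induction m with
  | zero => rfl
  | succ m ih =>
    rw [occBefore_succ, occBefore_succ, ih fun k hk => h k (hk.trans m.lt_succ_self)]
    by_cases hm : Involves i (e m)
    · rw [if_pos hm, if_pos ((h m m.lt_succ_self).1 hm)]
    · rw [if_neg hm, if_neg fun hm' => hm ((h m m.lt_succ_self).2 hm')]

/-- Pointwise fewer involvements give a smaller occurrence count. [folklore] -/
theorem occBefore_le_of_imp {i : Fin N} {e e' : ℕ → KickEntry N C C' ⊕ Unit} {m : ℕ}
    (h : ∀ k < m, Involves i (e k) → Involves i (e' k)) : occBefore i e m ≤ occBefore i e' m := by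
  induction m with
  | zero => exact le_rfl
  | succ m ih =>
    rw [occBefore_succ, occBefore_succ]
    have ih' := ih fun k hk => h k (hk.trans m.lt_succ_self)
    by_cases hm : Involves i (e m)
    · rw [if_pos hm, if_pos (h m m.lt_succ_self hm)]
      exact Nat.add_le_add_right ih' 1
    · rw [if_neg hm, add_zero]
      exact ih'.trans (Nat.le_add_right _ _)

/-- Slots not involving `i` between `m` and `m'` do not change the occurrence count. [folklore] -/
theorem occBefore_eq_of_forall_not_involves {i : Fin N} {e : ℕ → KickEntry N C C' ⊕ Unit} {m m' : ℕ}
    (hmm' : m ≤ m') (h : ∀ k, m ≤ k → k < m' → ¬ Involves i (e k)) :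
    occBefore i e m' = occBefore i e m := by
  induction m', hmm' using Nat.le_induction with
  | base => rfl
  | succ m' hmm' ih =>
    rw [occBefore_succ, if_neg (h m' hmm' m'.lt_succ_self), add_zero]
    exact ih fun k hk hk' => h k hk (hk'.trans m'.lt_succ_self)

/-- **Truncation of a slot sequence before the `n`-th collision of `i`** (`n = 0` is the first):
the slot `m` is kept iff at most `n` slots of index `≤ m` involve `i`, i.e. iff it comes strictly
BEFORE the slot of the `(n+1)`-st occurrence of `i`; all later slots (that one included) are
blanked. If `i` occurs at most `n` times, nothing is blanked. [folklore] -/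
def truncSeq (i : Fin N) (n : ℕ) (e : ℕ → KickEntry N C C' ⊕ Unit) : ℕ → KickEntry N C C' ⊕ Unit :=
  fun m => if occBefore i e (m + 1) ≤ n then e m else Sum.inr ()

/-- A slot before the `(n+1)`-st occurrence of `i` is kept. [folklore] -/
theorem truncSeq_of_le {i : Fin N} {n : ℕ} {e : ℕ → KickEntry N C C' ⊕ Unit} {m : ℕ}
    (h : occBefore i e (m + 1) ≤ n) : truncSeq i n e m = e m :=
  if_pos h

/-- A slot from the `(n+1)`-st occurrence of `i` on is blanked. [folklore] -/
theorem truncSeq_of_lt {i : Fin N} {n : ℕ} {e : ℕ → KickEntry N C C' ⊕ Unit} {m : ℕ}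
    (h : n < occBefore i e (m + 1)) : truncSeq i n e m = Sum.inr () :=
  if_neg (not_le.2 h)

/-- All the slots up to a kept slot are kept. [folklore] -/
theorem truncSeq_eq_of_le {i : Fin N} {n : ℕ} {e : ℕ → KickEntry N C C' ⊕ Unit} {m : ℕ}
    (h : occBefore i e (m + 1) ≤ n) {k : ℕ} (hk : k ≤ m) : truncSeq i n e k = e k :=
  truncSeq_of_le ((occBefore_mono i e (Nat.succ_le_succ hk)).trans h)

/-- A kept slot is the original slot; in particular an involved slot of the truncation is an
involved slot of the original, lying before the cut. [folklore] -/
theorem involves_of_involves_truncSeq {i j : Fin N} {n : ℕ} {e : ℕ → KickEntry N C C' ⊕ Unit}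
    {m : ℕ} (h : Involves j (truncSeq i n e m)) : Involves j (e m) ∧ occBefore i e (m + 1) ≤ n := by
  by_cases hm : occBefore i e (m + 1) ≤ n
  · rw [truncSeq_of_le hm] at h
    exact ⟨h, hm⟩
  · rw [truncSeq_of_lt (not_le.1 hm)] at h
    exact absurd h not_involves_inr

/-- Truncation only loses occurrences. [folklore] -/
theorem occBefore_truncSeq_le (i j : Fin N) (n : ℕ) (e : ℕ → KickEntry N C C' ⊕ Unit) (m : ℕ) :
    occBefore j (truncSeq i n e) m ≤ occBefore j e m :=
  occBefore_le_of_imp fun _ _ hk => (involves_of_involves_truncSeq hk).1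

/-- Before the cut the truncation has the same occurrence counts as the original. [folklore] -/
theorem occBefore_truncSeq_eq {i : Fin N} (j : Fin N) {n : ℕ} {e : ℕ → KickEntry N C C' ⊕ Unit}
    {m : ℕ} (h : occBefore i e m ≤ n) : occBefore j (truncSeq i n e) m = occBefore j e m := by
  refine occBefore_congr fun k hk => ?_
  rw [truncSeq_of_le ((occBefore_mono i e (Nat.succ_le_of_lt hk)).trans h)]

/-- The truncation before the `n`-th collision of `i` records at most `n` collisions of `i`.
[folklore] -/
theorem occBefore_truncSeq_self_le (i : Fin N) (n : ℕ) (e : ℕ → KickEntry N C C' ⊕ Unit) (m : ℕ) :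
    occBefore i (truncSeq i n e) m ≤ n := by
  induction m with
  | zero => exact Nat.zero_le n
  | succ m ih =>
    rw [occBefore_succ]
    by_cases hm : Involves i (truncSeq i n e m)
    · rw [if_pos hm]
      obtain ⟨-, hcut⟩ := involves_of_involves_truncSeq hm
      calc occBefore i (truncSeq i n e) m + 1
          = occBefore i (truncSeq i n e) (m + 1) := by rw [occBefore_succ, if_pos hm]
        _ ≤ occBefore i e (m + 1) := occBefore_truncSeq_le i i n e (m + 1)
        _ ≤ n := hcut
    · rw [if_neg hm, add_zero]
      exact ih

/-- **Nested truncations.** If the truncation of `e` before the `n`-th collision of `i` still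
records more than `n'` collisions of `i'` (i.e. the `n'`-th collision of `i'` is logged strictly
before the `n`-th collision of `i`), then truncating it further before the `n'`-th collision of
`i'` gives the truncation of `e` before the `n'`-th collision of `i'`. [folklore] -/
theorem truncSeq_truncSeq {i i' : Fin N} {n n' : ℕ} {e : ℕ → KickEntry N C C' ⊕ Unit}
    (h : ∃ m₀, n' < occBefore i' (truncSeq i n e) m₀) :
    truncSeq i' n' (truncSeq i n e) = truncSeq i' n' e := by
  obtain ⟨m₀, hm₀⟩ := h
  funext m
  by_cases hm : occBefore i e (m + 1) ≤ n
  · -- before the `i`-cut the two sequences, and their `i'`-counts, agree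
    have hocc : occBefore i' (truncSeq i n e) (m + 1) = occBefore i' e (m + 1) :=
      occBefore_truncSeq_eq i' hm
    by_cases hc : occBefore i' e (m + 1) ≤ n'
    · rw [truncSeq_of_le hc, truncSeq_of_le (hocc.le.trans hc), truncSeq_of_le hm]
    · rw [not_le] at hc
      rw [truncSeq_of_lt hc, truncSeq_of_lt (hc.trans_eq hocc.symm)]
  · -- from the `i`-cut on everything is blank; the `n' + 1` occurrences of `i'` in the
    -- truncation all lie before `m`, so the `i'`-cut of `e` is also at or before `m`
    rw [not_le] at hm
    have hblank : ∀ k, m ≤ k → ¬ Involves i' (truncSeq i n e k) := fun k hk hk' =>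
      (not_le.2 (hm.trans_le (occBefore_mono i e (Nat.succ_le_succ hk))))
        (involves_of_involves_truncSeq hk').2
    have h1 : occBefore i' (truncSeq i n e) m₀ ≤ occBefore i' (truncSeq i n e) m := by
      rcases le_total m₀ m with hle | hle
      · exact occBefore_mono _ _ hle
      · exact (occBefore_eq_of_forall_not_involves hle fun k hk hk' => hblank k hk).le
    have h2 : n' < occBefore i' e (m + 1) :=
      calc n' < occBefore i' (truncSeq i n e) m := hm₀.trans_le h1
        _ ≤ occBefore i' e m := occBefore_truncSeq_le i i' n e m
        _ ≤ occBefore i' e (m + 1) := occBefore_mono i' e m.le_succ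
    rw [truncSeq_of_lt h2]
    by_cases hc : occBefore i' (truncSeq i n e) (m + 1) ≤ n'
    · rw [truncSeq_of_le hc, truncSeq_of_lt hm]
    · rw [truncSeq_of_lt (not_le.1 hc)]

/-- **Truncations along one particle are nested**: truncating before the `n`-th collision of `i`
and then before the `n'`-th, `n' ≤ n`, is truncating before the `n'`-th. [folklore] -/
theorem truncSeq_truncSeq_of_le (i : Fin N) {n n' : ℕ} (h : n' ≤ n) (e : ℕ → KickEntry N C C' ⊕ Unit) :
    truncSeq i n' (truncSeq i n e) = truncSeq i n' e := by
  funext m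
  by_cases hm : occBefore i e (m + 1) ≤ n
  · have hocc : occBefore i (truncSeq i n e) (m + 1) = occBefore i e (m + 1) :=
      occBefore_truncSeq_eq i hm
    by_cases hc : occBefore i e (m + 1) ≤ n'
    · rw [truncSeq_of_le hc, truncSeq_of_le (hocc.le.trans hc), truncSeq_of_le hm]
    · rw [not_le] at hc
      rw [truncSeq_of_lt hc, truncSeq_of_lt (hc.trans_eq hocc.symm)]
  · rw [not_le] at hm
    rw [truncSeq_of_lt (h.trans_lt hm)]
    by_cases hc : occBefore i (truncSeq i n e) (m + 1) ≤ n'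
    · rw [truncSeq_of_le hc, truncSeq_of_lt hm]
    · rw [truncSeq_of_lt (not_le.1 hc)]

/-- **Truncation of a kick log before the `n`-th collision of `i`**: keep the initial coarse
configuration and the slots strictly before the `(n+1)`-st slot involving `i`, blank the rest.
[folklore] -/
def truncBefore (i : Fin N) (n : ℕ) (L : KickLog N C C') : KickLog N C C' := (L.1, truncSeq i n L.2)

/-- The kick log `L` **records the `n`-th collision of `i`** (`n = 0` the first): more than `n` of
its slots involve `i`. For a truncated log `truncBefore i' n' L` this says that the `n`-th collision
of `i` is logged STRICTLY BEFORE the `n'`-th collision of `i'`. [folklore] -/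
def Records (i : Fin N) (n : ℕ) (L : KickLog N C C') : Prop := ∃ m, n < occBefore i L.2 m

/-- Unfolding lemma for the truncation of a kick log. [folklore] -/
@[simp]
theorem truncBefore_fst (i : Fin N) (n : ℕ) (L : KickLog N C C') : (truncBefore i n L).1 = L.1 := rfl

/-- Unfolding lemma for the truncation of a kick log. [folklore] -/
@[simp]
theorem truncBefore_snd (i : Fin N) (n : ℕ) (L : KickLog N C C') :
    (truncBefore i n L).2 = truncSeq i n L.2 := rfl

/-- A truncated log does not record the collision it was truncated at. [folklore] -/
theorem not_records_truncBefore (i : Fin N) (n : ℕ) (L : KickLog N C C') :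
    ¬ Records i n (truncBefore i n L) := by
  rintro ⟨m, hm⟩
  exact (not_le.2 hm) (occBefore_truncSeq_self_le i n L.2 m)

/-- What a truncated log records, the log records. [folklore] -/
theorem Records.of_truncBefore {i i' : Fin N} {n n' : ℕ} {L : KickLog N C C'}
    (h : Records i' n' (truncBefore i n L)) : Records i' n' L := by
  obtain ⟨m, hm⟩ := h
  exact ⟨m, hm.trans_le (occBefore_truncSeq_le i i' n L.2 m)⟩

/-- **Nested truncations of a kick log**: if the log truncated before the `n`-th collision of `i`
records the `n'`-th collision of `i'`, truncating it further before the latter gives the log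
truncated before the `n'`-th collision of `i'`. [folklore] -/
theorem truncBefore_truncBefore {i i' : Fin N} {n n' : ℕ} {L : KickLog N C C'}
    (h : Records i' n' (truncBefore i n L)) :
    truncBefore i' n' (truncBefore i n L) = truncBefore i' n' L :=
  Prod.ext rfl (truncSeq_truncSeq h)

/-- Truncations of a kick log along one particle are nested. [folklore] -/
theorem truncBefore_truncBefore_of_le (i : Fin N) {n n' : ℕ} (h : n' ≤ n) (L : KickLog N C C') :
    truncBefore i n' (truncBefore i n L) = truncBefore i n' L :=
  Prod.ext rfl (truncSeq_truncSeq_of_le i h L.2)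

/-- Along one particle: if the log truncated before the `n`-th collision of `i` records the
`n'`-th collision of `i`, then `n' < n`. [folklore] -/
theorem lt_of_records_truncBefore {i : Fin N} {n n' : ℕ} {L : KickLog N C C'}
    (h : Records i n' (truncBefore i n L)) : n' < n := by
  obtain ⟨m, hm⟩ := h
  exact hm.trans_le (occBefore_truncSeq_self_le i n L.2 m)

/-- Along one particle, conversely: if `n' < n` and the log records the `n'`-th collision of `i`,
then so does the log truncated before the `n`-th collision of `i` (the truncations along one
particle are nested: a filtration in `n`). [folklore] -/
theorem Records.truncBefore_of_lt {i : Fin N} {n n' : ℕ} {L : KickLog N C C'} (h : Records i n' L)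
    (hn : n' < n) : Records i n' (truncBefore i n L) := by
  classical
  -- the first index at which more than `n'` occurrences of `i` have been seen
  obtain ⟨m, hm⟩ := h
  induction m with
  | zero => exact absurd hm (Nat.not_lt_zero _)
  | succ m ih =>
    by_cases hm' : n' < occBefore i L.2 m
    · exact ih hm'
    · -- the `(n'+1)`-st occurrence is at slot `m`, which is kept since `n' + 1 ≤ n`
      have hle : occBefore i L.2 m ≤ n' := not_lt.1 hm'
      have hcut : occBefore i L.2 (m + 1) ≤ n :=
        (occBefore_succ_le i L.2 m).trans ((Nat.add_le_add_right hle 1).trans (Nat.succ_le_of_lt hn))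
      refine ⟨m + 1, ?_⟩
      rw [truncBefore_snd, occBefore_truncSeq_eq i hcut]
      exact hm

section Measurable

variable [MeasurableSpace C] [MeasurableSpace C']

/-- The set of slots involving `i` is measurable. [folklore] -/
theorem measurableSet_involves (i : Fin N) :
    MeasurableSet {x : KickEntry N C C' ⊕ Unit | Involves i x} := by
  rw [measurableSet_sum_iff]
  constructor
  · have h1 : MeasurableSet {e : KickEntry N C C' | e.1.1 = i} :=
      measurable_fst.fst (measurableSet_singleton i)
    have h2 : MeasurableSet {e : KickEntry N C C' | e.1.2 = i} :=
      measurable_fst.snd (measurableSet_singleton i)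
    exact h1.union h2
  · have : Sum.inr ⁻¹' {x : KickEntry N C C' ⊕ Unit | Involves i x} = (∅ : Set Unit) :=
      Set.eq_empty_iff_forall_notMem.2 fun u hu => hu
    rw [this]
    exact MeasurableSet.empty

/-- The occurrence counts are measurable functions of the slot sequence. [folklore] -/
theorem measurable_occBefore (i : Fin N) (m : ℕ) :
    Measurable fun e : ℕ → KickEntry N C C' ⊕ Unit => occBefore i e m := by
  induction m with
  | zero => exact measurable_const
  | succ m ih =>
    have hs : MeasurableSet {e : ℕ → KickEntry N C C' ⊕ Unit | Involves i (e m)} :=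
      measurable_pi_apply (X := fun _ : ℕ => KickEntry N C C' ⊕ Unit) m (measurableSet_involves i)
    have hsucc : Measurable fun e : ℕ → KickEntry N C C' ⊕ Unit => occBefore i e m + 1 :=
      (Measurable.of_discrete (f := fun k : ℕ => k + 1)).comp ih
    exact Measurable.ite hs hsucc ih

/-- Truncation of slot sequences is measurable. [folklore] -/
theorem measurable_truncSeq (i : Fin N) (n : ℕ) :
    Measurable (truncSeq (C := C) (C' := C') i n) := by
  refine measurable_pi_lambda _ fun m => ?_
  have hs : MeasurableSet {e : ℕ → KickEntry N C C' ⊕ Unit | occBefore i e (m + 1) ≤ n} :=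
    measurable_occBefore i (m + 1) (MeasurableSet.of_discrete (s := {k : ℕ | k ≤ n}))
  exact Measurable.ite hs (measurable_pi_apply m) measurable_const

/-- Truncation of kick logs is measurable. [folklore] -/
theorem measurable_truncBefore (i : Fin N) (n : ℕ) :
    Measurable (truncBefore (C := C) (C' := C') i n) :=
  measurable_fst.prodMk ((measurable_truncSeq i n).comp measurable_snd)

/-- The set of kick logs recording the `n`-th collision of `i` is measurable. [folklore] -/
theorem measurableSet_records (i : Fin N) (n : ℕ) :
    MeasurableSet {L : KickLog N C C' | Records i n L} := by
  have : {L : KickLog N C C' | Records i n L} = ⋃ m, {L | n < occBefore i L.2 m} := by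
    ext L
    simp [Records]
  rw [this]
  refine MeasurableSet.iUnion fun m => ?_
  exact ((measurable_occBefore i m).comp measurable_snd)
    (MeasurableSet.of_discrete (s := {k : ℕ | n < k}))

end Measurable

/-! ### Sub-σ-algebras generated by truncated logs: the exact stopping-time monotonicity -/

section Sigma

variable {Ω : Type*} [MeasurableSpace C] [MeasurableSpace C']

/-- **Monotonicity of truncated-log σ-algebras (strict-past form).** For any log-valued map
`log : Ω → KickLog N C C'`, let `𝓕(i, n)` be the σ-algebra on `Ω` generated by the log truncated
before the `n`-th collision of `i`. If `E` is `𝓕(i', n')`-measurable, then `E ∩ A` is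
`𝓕(i, n)`-measurable, where `A` is the event "the log truncated before the `n`-th collision of
`i` records the `n'`-th collision of `i'`" (the `n'`-th collision of `i'` strictly precedes the
`n`-th collision of `i`) — the discrete analogue of `𝓕_S ∩ {S < T} ⊆ 𝓕_{T-}` for stopping
times. [folklore] -/
theorem measurableSet_inter_records_of_comap_truncBefore (log : Ω → KickLog N C C') {i i' : Fin N}
    {n n' : ℕ} {E : Set Ω}
    (hE : MeasurableSet[MeasurableSpace.comap (fun ω => truncBefore i' n' (log ω)) inferInstance] E) :
    MeasurableSet[MeasurableSpace.comap (fun ω => truncBefore i n (log ω)) inferInstance]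
      (E ∩ {ω | Records i' n' (truncBefore i n (log ω))}) := by
  obtain ⟨B, hB, rfl⟩ := hE
  refine ⟨truncBefore i' n' ⁻¹' B ∩ {L | Records i' n' L}, ?_, ?_⟩
  · exact (measurable_truncBefore i' n' hB).inter (measurableSet_records i' n')
  · ext ω
    simp only [Set.mem_preimage, Set.mem_inter_iff, Set.mem_setOf_eq]
    constructor
    · rintro ⟨hω, hr⟩
      exact ⟨by rwa [truncBefore_truncBefore hr] at hω, hr⟩
    · rintro ⟨hω, hr⟩
      exact ⟨by rwa [truncBefore_truncBefore hr], hr⟩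

/-- The precedence event itself is measurable for the later σ-algebra. [folklore] -/
theorem measurableSet_records_comap_truncBefore (log : Ω → KickLog N C C') (i i' : Fin N)
    (n n' : ℕ) :
    MeasurableSet[MeasurableSpace.comap (fun ω => truncBefore i n (log ω)) inferInstance]
      {ω | Records i' n' (truncBefore i n (log ω))} :=
  ⟨{L | Records i' n' L}, measurableSet_records i' n', rfl⟩

/-- **Along one particle the truncated-log σ-algebras form a filtration**: the σ-algebra generated
by the log truncated before the `n'`-th collision of `i` is contained in the one generated by the
log truncated before the `n`-th, `n' ≤ n`. [folklore] -/
theorem comap_truncBefore_mono (log : Ω → KickLog N C C') (i : Fin N) {n n' : ℕ} (h : n' ≤ n) :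
    MeasurableSpace.comap (fun ω => truncBefore i n' (log ω)) inferInstance ≤
      MeasurableSpace.comap (fun ω => truncBefore i n (log ω))
        (inferInstance : MeasurableSpace (KickLog N C C')) := by
  have hcomp : (fun ω => truncBefore i n' (log ω)) =
      truncBefore i n' ∘ fun ω => truncBefore i n (log ω) := by
    funext ω
    exact (truncBefore_truncBefore_of_le i h (log ω)).symm
  rw [hcomp, ← MeasurableSpace.comap_comp]
  exact MeasurableSpace.comap_mono (measurable_truncBefore i n').comap_le

/-- The initial coarse configuration is known to every truncated-log σ-algebra. [folklore] -/
theorem comap_fst_le_comap_truncBefore (log : Ω → KickLog N C C') (i : Fin N) (n : ℕ) :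
    MeasurableSpace.comap (fun ω => (log ω).1) inferInstance ≤
      MeasurableSpace.comap (fun ω => truncBefore i n (log ω))
        (inferInstance : MeasurableSpace (KickLog N C C')) := by
  have hcomp : (fun ω => (log ω).1) = Prod.fst ∘ fun ω => truncBefore i n (log ω) := rfl
  rw [hcomp, ← MeasurableSpace.comap_comp]
  exact MeasurableSpace.comap_mono measurable_fst.comap_le

end Sigma

end KickLog

/-! ## The colliding set and the coarse kick entry of a configuration; kick logs of a curve -/

section Kinetic

variable {d : Type*} [Fintype d] {X : Type*} {N : ℕ}

section Entry

variable {G : Geometry d X} {ε : ℝ}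

/-- The **colliding set** of the configuration `z`: the particles participating in a collision
(in contact with some other particle). On a hard-sphere trajectory it is the colliding pair
`{p, q}` at a collision time and empty otherwise (`IsHardSphereTrajectory.collidingSet_eq_pair`,
`collidingSet_eq_empty_of_not_mem`). [folklore] -/
def collidingSet (G : Geometry d X) (ε : ℝ) (z : Config N d X) : Finset (Fin N) :=
  (contactPairs G ε z).image Prod.fst ∪ (contactPairs G ε z).image Prod.snd

/-- Membership in the colliding set is participation. [folklore] -/
theorem mem_collidingSet {z : Config N d X} {k : Fin N} :
    k ∈ collidingSet G ε z ↔ Participates G ε z k := by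
  simp only [collidingSet, Finset.mem_union, Finset.mem_image]
  constructor
  · rintro (⟨p, hp, rfl⟩ | ⟨p, hp, rfl⟩)
    · exact ⟨p.2, Or.inl hp⟩
    · exact ⟨p.1, Or.inr hp⟩
  · rintro ⟨j, h | h⟩
    · exact Or.inl ⟨(k, j), h, rfl⟩
    · exact Or.inr ⟨(j, k), h, rfl⟩

/-- The colliding set is nonempty exactly at the collision times of a curve. [folklore] -/
theorem collidingSet_nonempty_iff {γ : ℝ → Config N d X} {t : ℝ} :
    (collidingSet G ε (γ t)).Nonempty ↔ t ∈ collisionTimes G ε γ := by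
  rw [mem_collisionTimes_iff_exists_participates]
  exact ⟨fun ⟨k, hk⟩ => ⟨k, mem_collidingSet.1 hk⟩, fun ⟨k, hk⟩ => ⟨k, mem_collidingSet.2 hk⟩⟩

/-- Off the collision times the colliding set is empty. [folklore] -/
theorem collidingSet_eq_empty_of_not_mem {γ : ℝ → Config N d X} {t : ℝ}
    (ht : t ∉ collisionTimes G ε γ) : collidingSet G ε (γ t) = ∅ :=
  Finset.not_nonempty_iff_eq_empty.1 fun h => ht (collidingSet_nonempty_iff.1 h)

/-- The **coarse kick entry of a configuration**: if some particles are in contact, the entry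
`Sum.inl ((k₁, k₂), (q x_{k₁}, qv v_{k₁}), (q x_{k₂}, qv v_{k₂}))` where `k₁ ≤ k₂` are the least
and the largest particle of the colliding set (THE colliding pair in increasing order at a binary
collision) and the states are read off `z` (along a right-continuous trajectory: the
POST-collisional states, i.e. the data of the two free flights starting at this collision);
the blank `Sum.inr ()` if nobody is in contact. [folklore] -/
def kickEntry {C C' : Type*} (G : Geometry d X) (ε : ℝ) (q : X → C) (qv : EuclideanSpace ℝ d → C')
    (z : Config N d X) : KickEntry N C C' ⊕ Unit :=
  if h : (collidingSet G ε z).Nonempty then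
    Sum.inl (((collidingSet G ε z).min' h, (collidingSet G ε z).max' h),
      (coarseConfigWith q qv z ((collidingSet G ε z).min' h),
        coarseConfigWith q qv z ((collidingSet G ε z).max' h)))
  else Sum.inr ()

variable {C C' : Type*} {q : X → C} {qv : EuclideanSpace ℝ d → C'}

/-- With somebody in contact the kick entry is the entry of the extreme particles of the
colliding set. [folklore] -/
theorem kickEntry_of_nonempty {z : Config N d X} (h : (collidingSet G ε z).Nonempty) :
    kickEntry G ε q qv z = Sum.inl (((collidingSet G ε z).min' h, (collidingSet G ε z).max' h),
      (coarseConfigWith q qv z ((collidingSet G ε z).min' h),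
        coarseConfigWith q qv z ((collidingSet G ε z).max' h))) :=
  dif_pos h

/-- With nobody in contact the kick entry is blank. [folklore] -/
theorem kickEntry_of_not_nonempty {z : Config N d X} (h : ¬ (collidingSet G ε z).Nonempty) :
    kickEntry G ε q qv z = Sum.inr () :=
  dif_neg h

/-- Off the collision times of a curve the kick entry is blank. [folklore] -/
theorem kickEntry_of_not_mem {γ : ℝ → Config N d X} {t : ℝ} (ht : t ∉ collisionTimes G ε γ) :
    kickEntry G ε q qv (γ t) = Sum.inr () :=
  kickEntry_of_not_nonempty fun h => ht (collidingSet_nonempty_iff.1 h)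

/-- A particle involved in the kick entry of `z` participates in a collision in `z`. [folklore] -/
theorem participates_of_involves_kickEntry {z : Config N d X} {i : Fin N}
    (h : KickLog.Involves i (kickEntry G ε q qv z)) : Participates G ε z i := by
  by_cases hne : (collidingSet G ε z).Nonempty
  · rw [kickEntry_of_nonempty hne, KickLog.involves_inl] at h
    rcases h with h | h
    · exact mem_collidingSet.1 (h ▸ Finset.min'_mem _ hne)
    · exact mem_collidingSet.1 (h ▸ Finset.max'_mem _ hne)
  · rw [kickEntry_of_not_nonempty hne] at h
    exact absurd h KickLog.not_involves_inr

/-- If at most two particles are in contact (a binary collision), a participating particle is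
involved in the kick entry. [folklore] -/
theorem involves_kickEntry_of_participates {z : Config N d X} {i : Fin N} (hi : Participates G ε z i)
    (h2 : (collidingSet G ε z).card ≤ 2) : KickLog.Involves i (kickEntry G ε q qv z) := by
  have hmem : i ∈ collidingSet G ε z := mem_collidingSet.2 hi
  have hne : (collidingSet G ε z).Nonempty := ⟨i, hmem⟩
  rw [kickEntry_of_nonempty hne, KickLog.involves_inl]
  by_contra hc
  push Not at hc
  -- `min' < i < max'` would give three distinct particles in contact
  have hlt1 : (collidingSet G ε z).min' hne < i :=
    lt_of_le_of_ne (Finset.min'_le _ _ hmem) hc.1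
  have hlt2 : i < (collidingSet G ε z).max' hne :=
    lt_of_le_of_ne (Finset.le_max' _ _ hmem) (Ne.symm hc.2)
  have h3 : 2 < (collidingSet G ε z).card := by
    rw [Finset.two_lt_card]
    exact ⟨_, Finset.min'_mem _ hne, i, hmem, _, Finset.max'_mem _ hne, hlt1.ne, (hlt1.trans hlt2).ne,
      hlt2.ne⟩
  exact (not_lt.2 h2) h3

end Entry

/-! ## Kick logs and pre-collision logs of a curve -/

section Log

variable {G : Geometry d X} {ε : ℝ} {C C' : Type*}

/-- The **coarse kick log of the curve `γ` after time `a`**: the coarse configuration at time `a`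
and, in slot `m`, the coarse kick entry of the configuration at the `m`-th collision time after `a`
(`nthCollisionTime`, `m = 0` the first). On a hard-sphere trajectory the slots list the collisions
after `a` in increasing time order (`IsHardSphereTrajectory.kickLog_spec`); past the last collision
(if there are finitely many) the enumerator, hence the log, takes junk values. [folklore] -/
def kickLog (G : Geometry d X) (ε : ℝ) (γ : ℝ → Config N d X) (q : X → C)
    (qv : EuclideanSpace ℝ d → C') (a : ℝ) : KickLog N C C' :=
  (coarseConfigWith q qv (γ a), fun m => kickEntry G ε q qv (γ (nthCollisionTime G ε γ a m)))

/-- The **coarse pre-collision log of the `n`-th collision of particle `i` after `a`** along the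
curve `γ`: the kick log after `a` truncated before the `(n+1)`-st slot involving `i` — the coarse
configuration at time `a` and the coarse entries (colliding pair, position cells and velocity cells
of the two new flights) of the collisions STRICTLY BEFORE the `n`-th collision of `i`; nothing at
or after it. [folklore] -/
def preCollisionLog (G : Geometry d X) (ε : ℝ) (γ : ℝ → Config N d X) (q : X → C)
    (qv : EuclideanSpace ℝ d → C') (a : ℝ) (i : Fin N) (n : ℕ) : KickLog N C C' :=
  KickLog.truncBefore i n (kickLog G ε γ q qv a)

/-- Unfolding lemma for the kick log. [folklore] -/
@[simp]
theorem kickLog_fst (γ : ℝ → Config N d X) (q : X → C) (qv : EuclideanSpace ℝ d → C') (a : ℝ) :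
    (kickLog G ε γ q qv a).1 = coarseConfigWith q qv (γ a) := rfl

/-- Unfolding lemma for the kick log. [folklore] -/
@[simp]
theorem kickLog_snd (γ : ℝ → Config N d X) (q : X → C) (qv : EuclideanSpace ℝ d → C') (a : ℝ)
    (m : ℕ) : (kickLog G ε γ q qv a).2 m = kickEntry G ε q qv (γ (nthCollisionTime G ε γ a m)) := rfl

/-- Unfolding lemma for the pre-collision log. [folklore] -/
theorem preCollisionLog_eq (γ : ℝ → Config N d X) (q : X → C) (qv : EuclideanSpace ℝ d → C')
    (a : ℝ) (i : Fin N) (n : ℕ) :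
    preCollisionLog G ε γ q qv a i n = KickLog.truncBefore i n (kickLog G ε γ q qv a) := rfl

/-- The pre-collision log keeps the coarse configuration at the initial time. [folklore] -/
@[simp]
theorem preCollisionLog_fst (γ : ℝ → Config N d X) (q : X → C) (qv : EuclideanSpace ℝ d → C')
    (a : ℝ) (i : Fin N) (n : ℕ) : (preCollisionLog G ε γ q qv a i n).1 = coarseConfigWith q qv (γ a) :=
  rfl

end Log

/-! ## Along the hard-sphere flow: the pre-collision history and its σ-algebra -/

namespace HardSphereFlow

variable [MeasureSpace X] [TopologicalSpace X] {G : Geometry d X} {ε : ℝ} {C C' : Type*}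

/-- The **coarse kick log of the orbit of `z`** after time `0`. [folklore] -/
def kickLog (Φ : HardSphereFlow G ε N) (q : X → C) (qv : EuclideanSpace ℝ d → C')
    (z : Config N d X) : KickLog N C C' :=
  FluidPDE.kickLog G ε (fun t => Φ.flow t z) q qv 0

/-- The **coarse pre-collision history of the `n`-th collision of particle `i`** (after time `0`,
`n = 0` the first), as a function of the initial datum `z`: the coarse initial configuration
`coarseConfigWith q qv (Φ_0 z)` (`= coarseConfigWith q qv z` on the good set) together with the
time-ordered sequence of the coarse entries — colliding pair, `q`-cells of the positions and
`qv`-cells of the outgoing velocities of its two members, i.e. the data of every free flight that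
STARTS strictly before this collision — of the collisions of the orbit at times `0 < s < t_c`,
`t_c = Φ.nthCollisionTimeOf i n z`; NOTHING at or after `t_c` (in particular not the outgoing data
of the collision itself), no collision times, and no data of particles in free flight
(`HardSphereFlow.preCollisionHistory_spec`). Junk off `Φ.good` and when `i` has at most `n`
collisions after time `0`. [folklore] -/
def preCollisionHistory (Φ : HardSphereFlow G ε N) (q : X → C) (qv : EuclideanSpace ℝ d → C')
    (i : Fin N) (n : ℕ) (z : Config N d X) : KickLog N C C' :=
  FluidPDE.preCollisionLog G ε (fun t => Φ.flow t z) q qv 0 i n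

/-- The **pre-collision σ-algebra of the `n`-th collision of particle `i`**: the σ-algebra on
initial data generated by the coarse pre-collision history `Φ.preCollisionHistory q qv i n`
(`MeasurableSpace.comap` of the product σ-algebra of kick logs), with respect to which conditional
expectations `MeasureTheory.condExp` "given the coarse past of the collision" are taken. It is a
sub-σ-algebra of the ambient one as soon as the history map is measurable (`preCollisionSigma_le`),
a filtration in `n` along each particle (`preCollisionSigma_mono`), and monotone along the
collision DAG in the strict-past sense (`MeasurableSet.inter_precedes`). [folklore] -/
abbrev preCollisionSigma [MeasurableSpace C] [MeasurableSpace C'] (Φ : HardSphereFlow G ε N)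
    (q : X → C) (qv : EuclideanSpace ℝ d → C') (i : Fin N) (n : ℕ) : MeasurableSpace (Config N d X) :=
  MeasurableSpace.comap (Φ.preCollisionHistory q qv i n) inferInstance

/-- The event that **the `n'`-th collision of `i'` is logged strictly before the `n`-th collision of
`i`**: the pre-collision history of the latter records the former (on the good set, for a genuine
`n`-th collision of `i`: `i'` collides more than `n'` times in `(0, t_c)`,
`HardSphereFlow.mem_precedes_iff`). [folklore] -/
def precedes (Φ : HardSphereFlow G ε N) (q : X → C) (qv : EuclideanSpace ℝ d → C') (i' : Fin N)
    (n' : ℕ) (i : Fin N) (n : ℕ) : Set (Config N d X) :=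
  {z | KickLog.Records i' n' (Φ.preCollisionHistory q qv i n z)}

variable (Φ : HardSphereFlow G ε N) (q : X → C) (qv : EuclideanSpace ℝ d → C')

/-- The pre-collision history is the truncation of the kick log of the orbit. [folklore] -/
theorem preCollisionHistory_eq_truncBefore (i : Fin N) (n : ℕ) (z : Config N d X) :
    Φ.preCollisionHistory q qv i n z = KickLog.truncBefore i n (Φ.kickLog q qv z) := rfl

/-- The pre-collision history keeps the coarse initial configuration (of `Φ_0 z`, which is `z` on
the good set). [folklore] -/
theorem preCollisionHistory_fst (i : Fin N) (n : ℕ) (z : Config N d X) :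
    (Φ.preCollisionHistory q qv i n z).1 = coarseConfigWith q qv (Φ.flow 0 z) := rfl

/-- On the good set the initial slot of the history is the coarse initial datum. [folklore] -/
theorem preCollisionHistory_fst_of_mem (i : Fin N) (n : ℕ) {z : Config N d X} (hz : z ∈ Φ.good) :
    (Φ.preCollisionHistory q qv i n z).1 = coarseConfigWith q qv z := by
  rw [preCollisionHistory_fst, Φ.flow_zero z hz]

/-- Membership in the precedence event. [folklore] -/
theorem mem_precedes {i' : Fin N} {n' : ℕ} {i : Fin N} {n : ℕ} {z : Config N d X} :
    z ∈ Φ.precedes q qv i' n' i n ↔ KickLog.Records i' n' (Φ.preCollisionHistory q qv i n z) :=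
  Iff.rfl

/-- **Factorisation of histories along the DAG**: on the precedence event, the pre-collision
history of the earlier collision is the truncation of the pre-collision history of the later one.
[folklore] -/
theorem preCollisionHistory_eq_of_mem_precedes {i' : Fin N} {n' : ℕ} {i : Fin N} {n : ℕ}
    {z : Config N d X} (hz : z ∈ Φ.precedes q qv i' n' i n) :
    Φ.preCollisionHistory q qv i' n' z =
      KickLog.truncBefore i' n' (Φ.preCollisionHistory q qv i n z) :=
  (KickLog.truncBefore_truncBefore hz).symm

/-- Along one particle the histories are nested truncations. [folklore] -/
theorem preCollisionHistory_eq_truncBefore_of_le (i : Fin N) {n n' : ℕ} (h : n' ≤ n)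
    (z : Config N d X) :
    Φ.preCollisionHistory q qv i n' z = KickLog.truncBefore i n' (Φ.preCollisionHistory q qv i n z) :=
  (KickLog.truncBefore_truncBefore_of_le i h _).symm

/-- A collision logged before the `n`-th collision of `i` along the same particle is an earlier
one: `n' < n`. [folklore] -/
theorem lt_of_mem_precedes_self {i : Fin N} {n n' : ℕ} {z : Config N d X}
    (hz : z ∈ Φ.precedes q qv i n' i n) : n' < n :=
  KickLog.lt_of_records_truncBefore hz

section Sigma

variable [MeasurableSpace C] [MeasurableSpace C']

/-- The pre-collision σ-algebra is a sub-σ-algebra of the ambient one as soon as the history map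
is measurable. [folklore] -/
theorem preCollisionSigma_le {i : Fin N} {n : ℕ} (h : Measurable (Φ.preCollisionHistory q qv i n)) :
    Φ.preCollisionSigma q qv i n ≤ (inferInstance : MeasurableSpace (Config N d X)) :=
  h.comap_le

/-- The history map is measurable with respect to the pre-collision σ-algebra (by construction).
[folklore] -/
theorem measurable_preCollisionHistory_preCollisionSigma (i : Fin N) (n : ℕ) :
    Measurable[Φ.preCollisionSigma q qv i n] (Φ.preCollisionHistory q qv i n) :=
  comap_measurable _

/-- **Filtration along a particle**: the pre-collision σ-algebras of the successive collisions of
one particle increase. [folklore] -/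
theorem preCollisionSigma_mono (i : Fin N) : Monotone fun n => Φ.preCollisionSigma q qv i n :=
  fun _ _ h => KickLog.comap_truncBefore_mono (Φ.kickLog q qv) i h

/-- The coarse initial configuration generates a sub-σ-algebra of every pre-collision σ-algebra.
[folklore] -/
theorem comap_coarseConfigWith_le_preCollisionSigma (i : Fin N) (n : ℕ) :
    MeasurableSpace.comap (fun z => coarseConfigWith q qv (Φ.flow 0 z)) inferInstance ≤
      Φ.preCollisionSigma q qv i n :=
  KickLog.comap_fst_le_comap_truncBefore (Φ.kickLog q qv) i n

/-- The precedence event is measurable for the pre-collision σ-algebra of the later collision.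
[folklore] -/
theorem measurableSet_precedes (i' : Fin N) (n' : ℕ) (i : Fin N) (n : ℕ) :
    MeasurableSet[Φ.preCollisionSigma q qv i n] (Φ.precedes q qv i' n' i n) :=
  KickLog.measurableSet_records_comap_truncBefore (Φ.kickLog q qv) i i' n n'

/-- **Monotonicity along the collision DAG (strict-past form).** An event measurable for the
pre-collision σ-algebra of the `n'`-th collision of `i'`, intersected with the event that this
collision is logged strictly before the `n`-th collision of `i`, is measurable for the
pre-collision σ-algebra of the latter: `𝓕_{c'} ∩ {c' ≺ c} ⊆ 𝓕_c`. (So, for a functional of the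
collision `c'` and a later collision `c`, conditional expectations given `𝓕_c` see everything
`𝓕_{c'}` sees on `{c' ≺ c}`.) [folklore] -/
theorem _root_.MeasurableSet.inter_precedes {i' : Fin N} {n' : ℕ} {i : Fin N} {n : ℕ}
    {E : Set (Config N d X)} (hE : MeasurableSet[Φ.preCollisionSigma q qv i' n'] E) :
    MeasurableSet[Φ.preCollisionSigma q qv i n] (E ∩ Φ.precedes q qv i' n' i n) :=
  KickLog.measurableSet_inter_records_of_comap_truncBefore (Φ.kickLog q qv) hE

end Sigma

end HardSphereFlow

end Kinetic

/-! ## Genuine enumerated times: the enumeration of a locally finite set with enough elements -/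

section Enumeration

variable {S : Set ℝ}

/-- Shifting the origin of the enumeration to the first enumerated time shifts the index by one.
[folklore] -/
theorem nthTimeAfter_succ_eq_nthTimeAfter_nthTimeAfter_zero (S : Set ℝ) (a : ℝ) (n : ℕ) :
    nthTimeAfter S a (n + 1) = nthTimeAfter S (nthTimeAfter S a 0) n := by
  simp only [nthTimeAfter, zero_add, Function.iterate_one]
  exact Function.iterate_succ_apply (nextTimeAfter S) (n + 1) a

/-- **Genuine enumerated times.** If `S` (finite on bounded intervals) has more than `n` elements
after `a`, then the enumerated times `nthTimeAfter S a j`, `j ≤ n`, are elements of `S` after `a`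
and increase strictly with `j` (no junk value is reached up to index `n`). [folklore] -/
theorem nthTimeAfter_chain_of_encard (hfin : ∀ a b, (S ∩ Ioc a b).Finite) {a : ℝ} {n : ℕ}
    (h : (n + 1 : ℕ∞) ≤ (S ∩ Ioi a).encard) :
    (∀ j ≤ n, nthTimeAfter S a j ∈ S ∧ a < nthTimeAfter S a j) ∧
      ∀ j < n, nthTimeAfter S a j < nthTimeAfter S a (j + 1) := by
  induction n generalizing a with
  | zero =>
    have hne : (S ∩ Ioi a).Nonempty := Set.one_le_encard_iff_nonempty.1 (by simpa using h)
    have hl := isLeast_nthTimeAfter_zero (hfin a) hne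
    refine ⟨fun j hj => ?_, fun j hj => absurd hj (Nat.not_lt_zero j)⟩
    obtain rfl : j = 0 := Nat.le_zero.1 hj
    exact ⟨hl.1.1, hl.1.2⟩
  | succ n ih =>
    have hne : (S ∩ Ioi a).Nonempty := Set.one_le_encard_iff_nonempty.1
      (le_trans (by exact_mod_cast Nat.le_add_left 1 (n + 1)) h)
    have hl := isLeast_nthTimeAfter_zero (hfin a) hne
    set t₀ := nthTimeAfter S a 0 with ht₀
    -- after the least element there are still more than `n` elements
    have hsub : (S ∩ Ioi a) \ {t₀} ⊆ S ∩ Ioi t₀ := fun u hu =>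
      ⟨hu.1.1, lt_of_le_of_ne (hl.2 hu.1) (Ne.symm hu.2)⟩
    have h' : (n + 1 : ℕ∞) ≤ (S ∩ Ioi t₀).encard := by
      refine le_trans ?_ (Set.encard_le_encard hsub)
      rw [Set.encard_sdiff_singleton_of_mem hl.1]
      refine (ENat.addLECancellable_of_ne_top ENat.one_ne_top).le_tsub_of_add_le_right ?_
      exact_mod_cast h
    obtain ⟨ih1, ih2⟩ := ih h'
    refine ⟨fun j hj => ?_, fun j hj => ?_⟩
    · rcases j with _ | j
      · exact ⟨hl.1.1, hl.1.2⟩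
      · rw [nthTimeAfter_succ_eq_nthTimeAfter_nthTimeAfter_zero]
        obtain ⟨hmem, hlt⟩ := ih1 j (Nat.le_of_succ_le_succ hj)
        exact ⟨hmem, hl.1.2.trans hlt⟩
    · rcases j with _ | j
      · rw [nthTimeAfter_succ_eq_nthTimeAfter_nthTimeAfter_zero]
        exact (ih1 0 (Nat.zero_le n)).2
      · rw [nthTimeAfter_succ_eq_nthTimeAfter_nthTimeAfter_zero,
          nthTimeAfter_succ_eq_nthTimeAfter_nthTimeAfter_zero S a (j + 1)]
        exact ih2 j (Nat.lt_of_succ_lt_succ hj)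

/-- **The enumeration with enough elements is the increasing bijection onto its window**: if `S`
(finite on bounded intervals) has more than `n` elements after `a`, then with
`t = nthTimeAfter S a n`: the enumerated times of index `≤ n` lie in `S ∩ (a, t]`, increase
strictly, and exhaust `S ∩ (a, t]`. [folklore] -/
theorem nthTimeAfter_enum_of_encard (hfin : ∀ a b, (S ∩ Ioc a b).Finite) {a : ℝ} {n : ℕ}
    (h : (n + 1 : ℕ∞) ≤ (S ∩ Ioi a).encard) :
    (∀ j ≤ n, nthTimeAfter S a j ∈ S ∩ Ioc a (nthTimeAfter S a n)) ∧
      StrictMonoOn (nthTimeAfter S a) (Iic n) ∧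
      ∀ u ∈ S ∩ Ioc a (nthTimeAfter S a n), ∃ j ≤ n, nthTimeAfter S a j = u := by
  obtain ⟨hch1, hch2⟩ := nthTimeAfter_chain_of_encard hfin h
  have hmono : StrictMonoOn (nthTimeAfter S a) (Iic n) :=
    strictMonoOn_Iic_of_lt_succ fun m hm => hch2 m hm
  obtain ⟨hs, has⟩ := hch1 n le_rfl
  obtain ⟨m, hm, hmem, hmono', honto⟩ := nthTimeAfter_enum hfin hs has
  -- the index found by the enumeration lemma is `n`
  obtain rfl : m = n := by
    by_contra hne
    rcases lt_or_gt_of_ne hne with hlt | hgt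
    · exact (hmono (mem_Iic.2 hlt.le) (mem_Iic.2 le_rfl) hlt).ne hm
    · exact (hmono' (mem_Iic.2 hgt.le) (mem_Iic.2 le_rfl) hgt).ne hm.symm
  exact ⟨hmem, hmono, honto⟩

/-- A window count gives the cardinality hypothesis: if `S` has more than `n` elements in some
window `(a, w]`, it has more than `n` elements after `a`. [folklore] -/
theorem le_encard_inter_Ioi_of_le_ncard {a w : ℝ} {n : ℕ} (h : n + 1 ≤ (S ∩ Ioc a w).ncard) :
    (n + 1 : ℕ∞) ≤ (S ∩ Ioi a).encard := by
  have hfin : (S ∩ Ioc a w).Finite := Set.finite_of_ncard_ne_zero (by omega)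
  calc (n + 1 : ℕ∞) = ((n + 1 : ℕ) : ℕ∞) := by push_cast; rfl
    _ ≤ ((S ∩ Ioc a w).ncard : ℕ∞) := by exact_mod_cast h
    _ = (S ∩ Ioc a w).encard := hfin.cast_ncard_eq
    _ ≤ (S ∩ Ioi a).encard := Set.encard_le_encard (inter_subset_inter_right _ Ioc_subset_Ioi_self)

/-- The initial segment `{0, …, n}` of `ℕ` has `n + 1` elements. [folklore] -/
theorem ncard_Iic_nat (n : ℕ) : (Set.Iic n).ncard = n + 1 := by
  rw [← Finset.card_range (n + 1), ← Set.ncard_coe_finset]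
  congr 1
  ext j
  simp

end Enumeration

/-! ## Interpretation on a hard-sphere trajectory: what the pre-collision log logs -/

section Spec

variable {d : Type*} [Fintype d] {X : Type*} {N : ℕ}

namespace IsHardSphereTrajectory

variable [TopologicalSpace X] {G : Geometry d X} {ε : ℝ} {γ : ℝ → Config N d X}

/-- On a hard-sphere trajectory the colliding set at a collision of the ordered pair `(p, q)` is
`{p, q}`. [folklore] -/
theorem collidingSet_eq_pair (h : IsHardSphereTrajectory G ε N γ) {t : ℝ} {p q : Fin N}
    (hp : (p, q) ∈ contactPairs G ε (γ t)) : collidingSet G ε (γ t) = {p, q} := by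
  ext k
  rw [mem_collidingSet, h.participates_iff hp, Finset.mem_insert, Finset.mem_singleton]

/-- On a hard-sphere trajectory at most two particles are in contact at any time. [folklore] -/
theorem card_collidingSet_le_two (h : IsHardSphereTrajectory G ε N γ) (t : ℝ) :
    (collidingSet G ε (γ t)).card ≤ 2 := by
  by_cases ht : t ∈ collisionTimes G ε γ
  · obtain ⟨⟨p, q⟩, hp⟩ := mem_collisionTimes_iff_contactPairs_nonempty.1 ht
    rw [h.collidingSet_eq_pair hp]
    exact Finset.card_le_two
  · rw [collidingSet_eq_empty_of_not_mem ht]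
    exact Nat.zero_le 2

/-- On a hard-sphere trajectory a particle is involved in the kick entry of the configuration at
time `t` iff it participates in a collision at time `t`. [folklore] -/
theorem involves_kickEntry_iff (h : IsHardSphereTrajectory G ε N γ) {C C' : Type*} (q : X → C)
    (qv : EuclideanSpace ℝ d → C') {t : ℝ} {i : Fin N} :
    KickLog.Involves i (kickEntry G ε q qv (γ t)) ↔ Participates G ε (γ t) i :=
  ⟨participates_of_involves_kickEntry,
    fun hi => involves_kickEntry_of_participates hi (h.card_collidingSet_le_two t)⟩

/-- **The collisions of a particle with enough collisions, in increasing order.** On a hard-sphere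
trajectory, if particle `k` collides more than `n` times after `a`, then with
`t = nthCollisionTimeOf G ε γ a k n`: the collision times of `k` of index `≤ n` lie in `(a, t]`,
increase strictly with the index, and exhaust the collision times of `k` in `(a, t]`. [folklore] -/
theorem nthCollisionTimeOf_enum_of_encard (h : IsHardSphereTrajectory G ε N γ) {a : ℝ} {k : Fin N}
    {n : ℕ} (hn : (n + 1 : ℕ∞) ≤ (collisionTimesOf G ε γ k ∩ Ioi a).encard) :
    (∀ j ≤ n, nthCollisionTimeOf G ε γ a k j ∈
        collisionTimesOf G ε γ k ∩ Ioc a (nthCollisionTimeOf G ε γ a k n)) ∧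
      StrictMonoOn (nthCollisionTimeOf G ε γ a k) (Iic n) ∧
      ∀ u ∈ collisionTimesOf G ε γ k ∩ Ioc a (nthCollisionTimeOf G ε γ a k n),
        ∃ j ≤ n, nthCollisionTimeOf G ε γ a k j = u :=
  nthTimeAfter_enum_of_encard (h.finite_collisionTimesOf_inter_Ioc k) hn

/-- On a hard-sphere trajectory, if particle `k` collides more than `n` times after `a`, it
collides exactly `n` times strictly between `a` and its `n`-th collision time after `a`. [folklore] -/
theorem ncard_collisionTimesOf_inter_Ioo (h : IsHardSphereTrajectory G ε N γ) {a : ℝ} {k : Fin N}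
    {n : ℕ} (hn : (n + 1 : ℕ∞) ≤ (collisionTimesOf G ε γ k ∩ Ioi a).encard) :
    (collisionTimesOf G ε γ k ∩ Ioo a (nthCollisionTimeOf G ε γ a k n)).ncard = n := by
  obtain ⟨hmem, hmono, honto⟩ := h.nthCollisionTimeOf_enum_of_encard hn
  set t := nthCollisionTimeOf G ε γ a k n with ht
  have himage : nthCollisionTimeOf G ε γ a k '' Iio n = collisionTimesOf G ε γ k ∩ Ioo a t := by
    ext u
    constructor
    · rintro ⟨j, hj, rfl⟩
      have hj' : j < n := hj
      obtain ⟨hS, haj, -⟩ := hmem j hj'.le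
      exact ⟨hS, haj, hmono (mem_Iic.2 hj'.le) (mem_Iic.2 le_rfl) hj'⟩
    · rintro ⟨hS, hau, hut⟩
      obtain ⟨j, hj, rfl⟩ := honto u ⟨hS, hau, hut.le⟩
      refine ⟨j, lt_of_le_of_ne hj ?_, rfl⟩
      rintro rfl
      exact lt_irrefl _ hut
  rw [← himage, (hmono.injOn.mono Iio_subset_Iic_self).ncard_image, ← Finset.coe_range,
    Set.ncard_coe_finset, Finset.card_range]

variable {C C' : Type*} (q : X → C) (qv : EuclideanSpace ℝ d → C')

/-- Counting occurrences in the kick log: if the global enumeration of the collision times after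
`a` reaches the collision time `t` at index `M` (increasingly and exhaustively, as provided by
`nthCollisionTime_enum`), then the number of slots of index `< M` of the kick log involving
particle `j` is the number of collisions of `j` in `(a, t)`. [folklore] -/
theorem occBefore_kickLog_eq_ncard (h : IsHardSphereTrajectory G ε N γ) {a t : ℝ} {M : ℕ}
    (hM : nthCollisionTime G ε γ a M = t)
    (hmem : ∀ m ≤ M, nthCollisionTime G ε γ a m ∈ collisionTimes G ε γ ∩ Ioc a t)
    (hmono : StrictMonoOn (nthCollisionTime G ε γ a) (Iic M))
    (honto : ∀ u ∈ collisionTimes G ε γ ∩ Ioc a t, ∃ m ≤ M, nthCollisionTime G ε γ a m = u)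
    (j : Fin N) :
    KickLog.occBefore j (kickLog G ε γ q qv a).2 M = (collisionTimesOf G ε γ j ∩ Ioo a t).ncard := by
  classical
  have hfilter : ((Finset.range M).filter fun m => KickLog.Involves j ((kickLog G ε γ q qv a).2 m)) =
      (Finset.range M).filter fun m => nthCollisionTime G ε γ a m ∈ collisionTimesOf G ε γ j := by
    refine Finset.filter_congr fun m _ => ?_
    rw [kickLog_snd, h.involves_kickEntry_iff q qv, mem_collisionTimesOf]
  have himage : nthCollisionTime G ε γ a ''
      (↑((Finset.range M).filter fun m => nthCollisionTime G ε γ a m ∈ collisionTimesOf G ε γ j) :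
        Set ℕ) = collisionTimesOf G ε γ j ∩ Ioo a t := by
    ext u
    simp only [Finset.coe_filter, Finset.mem_range, Set.mem_image, Set.mem_setOf_eq, Set.mem_inter_iff,
      Set.mem_Ioo]
    constructor
    · rintro ⟨m, ⟨hm, hj⟩, rfl⟩
      exact ⟨hj, (hmem m hm.le).2.1,
        hM ▸ hmono (mem_Iic.2 hm.le) (mem_Iic.2 le_rfl) hm⟩
    · rintro ⟨hj, hau, hut⟩
      obtain ⟨m, hm, rfl⟩ := honto u ⟨collisionTimesOf_subset γ j hj, hau, hut.le⟩
      refine ⟨m, ⟨lt_of_le_of_ne hm ?_, hj⟩, rfl⟩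
      rintro rfl
      exact lt_irrefl _ (hM ▸ hut)
  rw [KickLog.occBefore_eq_card, hfilter, ← Set.ncard_coe_finset, ← himage,
    (hmono.injOn.mono fun m hm => ?_).ncard_image]
  exact mem_Iic.2 (Finset.mem_range.1 (Finset.mem_filter.1 hm).1).le

/-- **What the pre-collision log logs.** On a hard-sphere trajectory let particle `k` collide more
than `n` times after `a`, and let `t = nthCollisionTimeOf G ε γ a k n` be its `n`-th collision
time after `a`. Then there is an index `M` such that the collision times
`s_m = nthCollisionTime G ε γ a m`, `m ≤ M`, list the collision times in `(a, t]` increasingly and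
exhaustively with `s_M = t`, and the pre-collision log of the `n`-th collision of `k` consists of
the coarse configuration at time `a` and, in the slots `m < M`, of the kick entries of the
configurations `γ s_m` — the collisions strictly before `t`, in increasing time order — all later
slots being blank. [folklore] -/
theorem preCollisionLog_spec (h : IsHardSphereTrajectory G ε N γ) {a : ℝ} {k : Fin N} {n : ℕ}
    (hn : (n + 1 : ℕ∞) ≤ (collisionTimesOf G ε γ k ∩ Ioi a).encard) :
    ∃ M, nthCollisionTime G ε γ a M = nthCollisionTimeOf G ε γ a k n ∧
      (∀ m ≤ M, nthCollisionTime G ε γ a m ∈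
        collisionTimes G ε γ ∩ Ioc a (nthCollisionTimeOf G ε γ a k n)) ∧
      StrictMonoOn (nthCollisionTime G ε γ a) (Iic M) ∧
      (∀ u ∈ collisionTimes G ε γ ∩ Ioc a (nthCollisionTimeOf G ε γ a k n),
        ∃ m ≤ M, nthCollisionTime G ε γ a m = u) ∧
      KickLog.occBefore k (kickLog G ε γ q qv a).2 M = n ∧
      KickLog.Involves k ((kickLog G ε γ q qv a).2 M) ∧
      ∀ m, (preCollisionLog G ε γ q qv a k n).2 m =
        if m < M then kickEntry G ε q qv (γ (nthCollisionTime G ε γ a m)) else Sum.inr () := by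
  set t := nthCollisionTimeOf G ε γ a k n with ht
  obtain ⟨hmemk, -, -⟩ := h.nthCollisionTimeOf_enum_of_encard hn
  obtain ⟨htk, hat, -⟩ := hmemk n le_rfl
  obtain ⟨M, hM, hmem, hmono, honto⟩ :=
    h.nthCollisionTime_enum (collisionTimesOf_subset γ k htk) hat
  have hocc : KickLog.occBefore k (kickLog G ε γ q qv a).2 M = n := by
    rw [h.occBefore_kickLog_eq_ncard q qv hM hmem hmono honto k]
    exact h.ncard_collisionTimesOf_inter_Ioo hn
  have hinv : KickLog.Involves k ((kickLog G ε γ q qv a).2 M) := by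
    rw [kickLog_snd, hM, h.involves_kickEntry_iff q qv]
    exact htk
  refine ⟨M, hM, hmem, hmono, honto, hocc, hinv, fun m => ?_⟩
  have hiff : KickLog.occBefore k (kickLog G ε γ q qv a).2 (m + 1) ≤ n ↔ m < M := by
    constructor
    · intro hle
      by_contra hMm
      have hMm' : M + 1 ≤ m + 1 := Nat.succ_le_succ (not_lt.1 hMm)
      have := (KickLog.occBefore_mono k _ hMm').trans hle
      rw [KickLog.occBefore_succ, if_pos hinv, hocc] at this
      exact Nat.not_succ_le_self n this
    · intro hlt
      exact (KickLog.occBefore_mono k _ (Nat.succ_le_of_lt hlt)).trans hocc.le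
  rw [preCollisionLog_eq, KickLog.truncBefore_snd]
  by_cases hm : m < M
  · rw [if_pos hm, KickLog.truncSeq_of_le (hiff.2 hm), kickLog_snd]
  · rw [if_neg hm, KickLog.truncSeq_of_lt (not_le.1 fun hle => hm (hiff.1 hle))]

/-- **What the pre-collision log records.** On a hard-sphere trajectory, for a particle `k`
colliding more than `n` times after `a` (`t` its `n`-th collision time after `a`), the
pre-collision log of the `n`-th collision of `k` records the `n'`-th collision of `i'` iff `i'`
collides more than `n'` times in `(a, t)`. [folklore] -/
theorem records_preCollisionLog_iff (h : IsHardSphereTrajectory G ε N γ) {a : ℝ} {k : Fin N} {n : ℕ}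
    (hn : (n + 1 : ℕ∞) ≤ (collisionTimesOf G ε γ k ∩ Ioi a).encard) {i' : Fin N} {n' : ℕ} :
    KickLog.Records i' n' (preCollisionLog G ε γ q qv a k n) ↔
      n' + 1 ≤ (collisionTimesOf G ε γ i' ∩ Ioo a (nthCollisionTimeOf G ε γ a k n)).ncard := by
  obtain ⟨M, hM, hmem, hmono, honto, hocc, hinv, hslots⟩ := h.preCollisionLog_spec q qv hn
  have hcount := h.occBefore_kickLog_eq_ncard q qv hM hmem hmono honto i'
  -- the truncated sequence agrees with the log below `M` and is blank from `M` on
  have hcutM : KickLog.occBefore k (kickLog G ε γ q qv a).2 M ≤ n := hocc.le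
  have hbelow : KickLog.occBefore i' (preCollisionLog G ε γ q qv a k n).2 M =
      KickLog.occBefore i' (kickLog G ε γ q qv a).2 M := by
    rw [preCollisionLog_eq, KickLog.truncBefore_snd]
    exact KickLog.occBefore_truncSeq_eq i' hcutM
  have habove : ∀ m, M ≤ m → KickLog.occBefore i' (preCollisionLog G ε γ q qv a k n).2 m =
      KickLog.occBefore i' (preCollisionLog G ε γ q qv a k n).2 M := fun m hMm =>
    KickLog.occBefore_eq_of_forall_not_involves hMm fun j hj _ => by
      rw [hslots j, if_neg (not_lt.2 hj)]
      exact KickLog.not_involves_inr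
  rw [← hcount, ← hbelow, Nat.succ_le_iff]
  constructor
  · rintro ⟨m, hm⟩
    rcases le_total M m with hMm | hmM
    · rwa [habove m hMm] at hm
    · exact hm.trans_le (KickLog.occBefore_mono i' _ hmM)
  · exact fun hlt => ⟨M, hlt⟩

/-- **Records is time precedence.** On a hard-sphere trajectory, for a particle `k` colliding
more than `n` times after `a` (`t` its `n`-th collision time after `a`): `i'` collides more than
`n'` times in `(a, t)` iff `i'` collides more than `n'` times after `a` and its `n'`-th collision
time after `a` is `< t`. [folklore] -/
theorem le_ncard_collisionTimesOf_inter_Ioo_iff (h : IsHardSphereTrajectory G ε N γ) {a t : ℝ}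
    {i' : Fin N} {n' : ℕ} :
    n' + 1 ≤ (collisionTimesOf G ε γ i' ∩ Ioo a t).ncard ↔
      (n' + 1 : ℕ∞) ≤ (collisionTimesOf G ε γ i' ∩ Ioi a).encard ∧
        nthCollisionTimeOf G ε γ a i' n' < t := by
  have hfin : (collisionTimesOf G ε γ i' ∩ Ioo a t).Finite :=
    h.finite_collisionTimesOf_inter_of_subset_Icc i' Ioo_subset_Icc_self
  constructor
  · intro hle
    have hgen : (n' + 1 : ℕ∞) ≤ (collisionTimesOf G ε γ i' ∩ Ioi a).encard :=
      calc (n' + 1 : ℕ∞) = ((n' + 1 : ℕ) : ℕ∞) := by push_cast; rfl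
        _ ≤ ((collisionTimesOf G ε γ i' ∩ Ioo a t).ncard : ℕ∞) := by exact_mod_cast hle
        _ = (collisionTimesOf G ε γ i' ∩ Ioo a t).encard := hfin.cast_ncard_eq
        _ ≤ _ := Set.encard_le_encard (inter_subset_inter_right _ Ioo_subset_Ioi_self)
    refine ⟨hgen, ?_⟩
    obtain ⟨hmem, hmono, honto⟩ := h.nthCollisionTimeOf_enum_of_encard hgen
    by_contra hnot
    rw [not_lt] at hnot
    -- every collision of `i'` in `(a, t)` is an enumerated time of index `< n'`
    have hsub : collisionTimesOf G ε γ i' ∩ Ioo a t ⊆ nthCollisionTimeOf G ε γ a i' '' Iio n' := by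
      rintro u ⟨hu, hau, hut⟩
      obtain ⟨j, hj, rfl⟩ := honto u ⟨hu, hau, hut.le.trans hnot⟩
      refine ⟨j, lt_of_le_of_ne hj ?_, rfl⟩
      rintro rfl
      exact (not_le.2 hut) hnot
    have hcard : (collisionTimesOf G ε γ i' ∩ Ioo a t).ncard ≤ n' :=
      calc (collisionTimesOf G ε γ i' ∩ Ioo a t).ncard
          ≤ (nthCollisionTimeOf G ε γ a i' '' Iio n').ncard :=
            Set.ncard_le_ncard hsub ((Set.finite_Iio n').image _)
        _ ≤ (Iio n').ncard := Set.ncard_image_le (Set.finite_Iio n')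
        _ = n' := by rw [← Finset.coe_range, Set.ncard_coe_finset, Finset.card_range]
    omega
  · rintro ⟨hgen, hlt⟩
    obtain ⟨hmem, hmono, -⟩ := h.nthCollisionTimeOf_enum_of_encard hgen
    have hsub : nthCollisionTimeOf G ε γ a i' '' Iic n' ⊆ collisionTimesOf G ε γ i' ∩ Ioo a t := by
      rintro u ⟨j, hj, rfl⟩
      obtain ⟨hu, haj, hjn⟩ := hmem j hj
      exact ⟨hu, haj, hjn.trans_lt hlt⟩
    calc n' + 1 = (Iic n').ncard := (ncard_Iic_nat n').symm
      _ = (nthCollisionTimeOf G ε γ a i' '' Iic n').ncard := (hmono.injOn.ncard_image).symm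
      _ ≤ (collisionTimesOf G ε γ i' ∩ Ioo a t).ncard := Set.ncard_le_ncard hsub hfin

end IsHardSphereTrajectory

/-! ## Interpretation along the hard-sphere flow, on the good set -/

namespace HardSphereFlow

variable [MeasureSpace X] [TopologicalSpace X] {G : Geometry d X} {ε : ℝ} {C C' : Type*}
  (Φ : HardSphereFlow G ε N) (q : X → C) (qv : EuclideanSpace ℝ d → C')

/-- The window count of the routes gives genuineness: if particle `i` collides at least `n + 1`
times in `(0, w]` along the orbit of `z`, it collides more than `n` times after `0`. [folklore] -/
theorem le_encard_collisionTimesOf_of_le_ncard {z : Config N d X} {i : Fin N} {n : ℕ} {w : ℝ}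
    (h : n + 1 ≤ (collisionTimesOf G ε (fun t => Φ.flow t z) i ∩ Ioc 0 w).ncard) :
    (n + 1 : ℕ∞) ≤ (collisionTimesOf G ε (fun t => Φ.flow t z) i ∩ Ioi 0).encard :=
  le_encard_inter_Ioi_of_le_ncard h

/-- **What the pre-collision history logs, along the flow.** On the good set, if particle `i`
collides more than `n` times after time `0` along the orbit of `z` and `t_c = Φ.nthCollisionTimeOf
i n z` is its `n`-th collision time, then there is an index `M` such that the collision times
`s_m` of the orbit after `0` (`nthCollisionTime`, `m ≤ M`) list the collision times in `(0, t_c]`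
increasingly and exhaustively with `s_M = t_c`, and the pre-collision history consists of the
coarse initial datum `coarseConfigWith q qv z` and, in the slots `m < M`, of the kick entries of
the post-collisional configurations `Φ_{s_m} z` of the collisions strictly before `t_c`, all later
slots being blank. [folklore] -/
theorem preCollisionHistory_spec {z : Config N d X} (hz : z ∈ Φ.good) {i : Fin N} {n : ℕ}
    (hn : (n + 1 : ℕ∞) ≤ (collisionTimesOf G ε (fun t => Φ.flow t z) i ∩ Ioi 0).encard) :
    (Φ.preCollisionHistory q qv i n z).1 = coarseConfigWith q qv z ∧
    ∃ M, nthCollisionTime G ε (fun t => Φ.flow t z) 0 M = Φ.nthCollisionTimeOf i n z ∧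
      (∀ m ≤ M, nthCollisionTime G ε (fun t => Φ.flow t z) 0 m ∈
        collisionTimes G ε (fun t => Φ.flow t z) ∩ Ioc 0 (Φ.nthCollisionTimeOf i n z)) ∧
      StrictMonoOn (nthCollisionTime G ε (fun t => Φ.flow t z) 0) (Iic M) ∧
      (∀ u ∈ collisionTimes G ε (fun t => Φ.flow t z) ∩ Ioc 0 (Φ.nthCollisionTimeOf i n z),
        ∃ m ≤ M, nthCollisionTime G ε (fun t => Φ.flow t z) 0 m = u) ∧
      ∀ m, (Φ.preCollisionHistory q qv i n z).2 m =
        if m < M then kickEntry G ε q qv (Φ.flow (nthCollisionTime G ε (fun t => Φ.flow t z) 0 m) z)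
        else Sum.inr () := by
  refine ⟨Φ.preCollisionHistory_fst_of_mem q qv i n hz, ?_⟩
  obtain ⟨M, hM, hmem, hmono, honto, -, -, hslots⟩ :=
    (Φ.isTrajectory z hz).preCollisionLog_spec q qv hn
  exact ⟨M, hM, hmem, hmono, honto, hslots⟩

/-- **The precedence event is a collision count**, along the flow: on the good set, for a particle
`i` colliding more than `n` times after `0`, the initial datum `z` lies in
`Φ.precedes q qv i' n' i n` iff `i'` collides at least `n' + 1` times strictly between `0` and the
`n`-th collision time of `i`. [folklore] -/
theorem mem_precedes_iff {z : Config N d X} (hz : z ∈ Φ.good) {i : Fin N} {n : ℕ}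
    (hn : (n + 1 : ℕ∞) ≤ (collisionTimesOf G ε (fun t => Φ.flow t z) i ∩ Ioi 0).encard)
    {i' : Fin N} {n' : ℕ} :
    z ∈ Φ.precedes q qv i' n' i n ↔
      n' + 1 ≤ (collisionTimesOf G ε (fun t => Φ.flow t z) i' ∩
        Ioo 0 (Φ.nthCollisionTimeOf i n z)).ncard :=
  (Φ.isTrajectory z hz).records_preCollisionLog_iff q qv hn

/-- **The precedence event is time precedence**, along the flow: on the good set, for a particle
`i` colliding more than `n` times after `0`, `z ∈ Φ.precedes q qv i' n' i n` iff `i'` collides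
more than `n'` times after `0` and its `n'`-th collision happens strictly before the `n`-th
collision of `i`: `Φ.nthCollisionTimeOf i' n' z < Φ.nthCollisionTimeOf i n z`. [folklore] -/
theorem mem_precedes_iff_lt {z : Config N d X} (hz : z ∈ Φ.good) {i : Fin N} {n : ℕ}
    (hn : (n + 1 : ℕ∞) ≤ (collisionTimesOf G ε (fun t => Φ.flow t z) i ∩ Ioi 0).encard)
    {i' : Fin N} {n' : ℕ} :
    z ∈ Φ.precedes q qv i' n' i n ↔
      (n' + 1 : ℕ∞) ≤ (collisionTimesOf G ε (fun t => Φ.flow t z) i' ∩ Ioi 0).encard ∧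
        Φ.nthCollisionTimeOf i' n' z < Φ.nthCollisionTimeOf i n z := by
  rw [Φ.mem_precedes_iff q qv hz hn]
  exact (Φ.isTrajectory z hz).le_ncard_collisionTimesOf_inter_Ioo_iff

/-- Along one particle, on the good set: for a particle `i` colliding more than `n` times after
`0`, the `n'`-th collision of `i` precedes the `n`-th iff `n' < n`. [folklore] -/
theorem mem_precedes_self_iff {z : Config N d X} (hz : z ∈ Φ.good) {i : Fin N} {n : ℕ}
    (hn : (n + 1 : ℕ∞) ≤ (collisionTimesOf G ε (fun t => Φ.flow t z) i ∩ Ioi 0).encard) {n' : ℕ} :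
    z ∈ Φ.precedes q qv i n' i n ↔ n' < n := by
  rw [Φ.mem_precedes_iff q qv hz hn, Φ.nthCollisionTimeOf_eq,
    (Φ.isTrajectory z hz).ncard_collisionTimesOf_inter_Ioo hn, Nat.succ_le_iff]

end HardSphereFlow

end Spec

end

end Literature.Analysis.FluidPDE
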